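import Literature.MathematicalPhysics.QuantumLattice.ApproximatingHamiltonianProofs
import Mathlib
import HarnessLib

/-!
# Quantum belief propagation, part 5: local perturbations perturb locally — inside a symmetry sector

Helper file (theorems only, model-free) for stub B (`stub_farCutCurrent_of_clustering`) of the line
`gauge_qbp_far_seam` (cruxes `TcThermcert1.ThermalStiffnessCeilingU8b8_le_7o44` / `…U8b10_le_1o8`,
route `hubbard-tc-thermcert-1`).  This is the abstract core of Capel–Moscolari–Teufel–Wessel, Thm. 14
("local perturbations perturb locally", LPPL), in the CANONICAL-SECTOR form the line needs: all
operators `H`, `V`, `E`, `Ẽ`, `A` are sector preserving for a coordinate predicate `p` (no matrix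
entries between `p` and its complement — verbatim the line's `SectorPreserving`), states are the Gibbs
states of the COMPRESSIONS `H_p := H.toBlock p p`, and the QBP conjugation
`e^{-β(H+V)} = E e^{-βH} Eᴴ` (part 3, `exists_qbp_conjugation` at `s = 1`) is an identity on the full space.

* §1 block calculus for sector-preserving matrices (products, adjoints, `exp`, Gibbs weights compress;
  `‖X_p‖ ≤ ‖X‖`); §2 the LPPL identities `e^{-β(H_p+V_p)} = E_p e^{-βH_p} E_pᴴ`,
  `ρ₁(A') ρ₀(E_pᴴ E_p) = ρ₀(E_pᴴ A' E_p)`, `ρ₀(E_pᴴE_p) = Z_p(H+V)/Z_p(H) ≥ e^{-β‖V‖}`; §3 the ESTIMATE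
  (CMTW Thm 14, eqs. (4.3)–(4.5)): `Ẽ A = A Ẽ`, `‖E‖, ‖Ẽ‖ ≤ R`, `‖E - Ẽ‖ ≤ δ` give
  `|ρ₁(A_p) - ρ₀(A_p)| ≤ e^{β‖V‖} (Cov_{ρ₀}((ẼᴴẼ)_p ; A_p) + 4 R δ ‖A‖)`; in the line `Ẽ = Ẽ_r` is the QBP
  conjugation of the dynamics restricted to an `r`-collar of the seam, `δ = δ(r)` comes from Lieb–Robinson,
  and the covariance is what Hypothesis C (`CurrentClustering`) bounds.
[cite: CapelEtAl2023, Theorem 14 and its proof, eqs. (4.3)–(4.5); arXiv:2310.09182]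
-/

noncomputable section

open Matrix Literature.MathematicalPhysics.QuantumLattice
open scoped Matrix.Norms.L2Operator ComplexConjugate

namespace Summit.Ventures.CertifiedManyBodySolver.Theorems.TcThermcert1.GaugeQbpFarSeam

variable {ι : Type*} [Fintype ι] [DecidableEq ι]

/-! ## §1 Block calculus for sector-preserving matrices -/

section Block

variable (p : ι → Prop) [DecidablePred p]

omit [Fintype ι] [DecidableEq ι] [DecidablePred p] in
/-- A sector-preserving matrix has vanishing off-diagonal blocks. [folklore] -/
theorem toBlock_offDiag_eq_zero_of_sectorPreserving {X : Matrix ι ι ℂ}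
    (hX : ∀ i j, p i → ¬ p j → X i j = 0 ∧ X j i = 0) :
    X.toBlock p (fun a => ¬ p a) = 0 ∧ X.toBlock (fun a => ¬ p a) p = 0 := by
  constructor
  · ext a b
    exact (hX a b a.2 b.2).1
  · ext a b
    exact (hX b a b.2 a.2).2

omit [DecidableEq ι] in
/-- `(X Y)_p = X_p Y_p` when the LEFT factor is sector preserving. [folklore] -/
theorem toBlock_mul_of_sectorPreserving_left {X : Matrix ι ι ℂ}
    (hX : ∀ i j, p i → ¬ p j → X i j = 0 ∧ X j i = 0) (Y : Matrix ι ι ℂ) :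
    (X * Y).toBlock p p = X.toBlock p p * Y.toBlock p p := by
  rw [toBlock_mul_eq_add p p p X Y, (toBlock_offDiag_eq_zero_of_sectorPreserving p hX).1,
    Matrix.zero_mul, add_zero]

omit [DecidableEq ι] in
/-- `(X Y)_p = X_p Y_p` when the RIGHT factor is sector preserving. [folklore] -/
theorem toBlock_mul_of_sectorPreserving_right (X : Matrix ι ι ℂ) {Y : Matrix ι ι ℂ}
    (hY : ∀ i j, p i → ¬ p j → Y i j = 0 ∧ Y j i = 0) :
    (X * Y).toBlock p p = X.toBlock p p * Y.toBlock p p := by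
  rw [toBlock_mul_eq_add p p p X Y, (toBlock_offDiag_eq_zero_of_sectorPreserving p hY).2,
    Matrix.mul_zero, add_zero]

omit [Fintype ι] [DecidableEq ι] [DecidablePred p] in
/-- The adjoint of a sector-preserving matrix is sector preserving. [folklore] -/
theorem sectorPreserving_conjTranspose {X : Matrix ι ι ℂ}
    (hX : ∀ i j, p i → ¬ p j → X i j = 0 ∧ X j i = 0) :
    ∀ i j, p i → ¬ p j → Xᴴ i j = 0 ∧ Xᴴ j i = 0 := by
  intro i j hi hj
  obtain ⟨h1, h2⟩ := hX i j hi hj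
  simp [conjTranspose_apply, h1, h2]

omit [Fintype ι] [DecidableEq ι] [DecidablePred p] in
/-- Sums of sector-preserving matrices are sector preserving. [folklore] -/
theorem sectorPreserving_add {X Y : Matrix ι ι ℂ}
    (hX : ∀ i j, p i → ¬ p j → X i j = 0 ∧ X j i = 0) (hY : ∀ i j, p i → ¬ p j → Y i j = 0 ∧ Y j i = 0) :
    ∀ i j, p i → ¬ p j → (X + Y) i j = 0 ∧ (X + Y) j i = 0 := by
  intro i j hi hj
  obtain ⟨h1, h2⟩ := hX i j hi hj
  obtain ⟨h3, h4⟩ := hY i j hi hj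
  simp [h1, h2, h3, h4]

omit [Fintype ι] [DecidableEq ι] [DecidablePred p] in
/-- Scalar multiples of sector-preserving matrices are sector preserving. [folklore] -/
theorem sectorPreserving_smul {X : Matrix ι ι ℂ} (c : ℂ)
    (hX : ∀ i j, p i → ¬ p j → X i j = 0 ∧ X j i = 0) :
    ∀ i j, p i → ¬ p j → (c • X) i j = 0 ∧ (c • X) j i = 0 := by
  intro i j hi hj
  obtain ⟨h1, h2⟩ := hX i j hi hj
  simp [h1, h2]

omit [DecidableEq ι] in
/-- Products of sector-preserving matrices are sector preserving. [folklore] -/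
theorem sectorPreserving_mul {X Y : Matrix ι ι ℂ}
    (hX : ∀ i j, p i → ¬ p j → X i j = 0 ∧ X j i = 0) (hY : ∀ i j, p i → ¬ p j → Y i j = 0 ∧ Y j i = 0) :
    ∀ i j, p i → ¬ p j → (X * Y) i j = 0 ∧ (X * Y) j i = 0 := by
  intro i j hi hj
  constructor
  · rw [Matrix.mul_apply]
    refine Finset.sum_eq_zero fun k _ => ?_
    by_cases hk : p k
    · rw [(hY k j hk hj).1, mul_zero]
    · rw [(hX i k hi hk).1, zero_mul]
  · rw [Matrix.mul_apply]
    refine Finset.sum_eq_zero fun k _ => ?_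
    by_cases hk : p k
    · rw [(hX k j hk hj).2, zero_mul]
    · rw [(hY i k hi hk).2, mul_zero]

omit [Fintype ι] [DecidableEq ι] [DecidablePred p] in
/-- Compression commutes with the adjoint: `(X_p)ᴴ = (Xᴴ)_p`. [folklore] -/
theorem conjTranspose_toBlock (X : Matrix ι ι ℂ) : (X.toBlock p p)ᴴ = Xᴴ.toBlock p p := rfl

/-- `(X^k)_p = (X_p)^k` for sector-preserving `X`. [folklore] -/
theorem toBlock_pow_of_sectorPreserving {X : Matrix ι ι ℂ}
    (hX : ∀ i j, p i → ¬ p j → X i j = 0 ∧ X j i = 0) (k : ℕ) :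
    (X ^ k).toBlock p p = (X.toBlock p p) ^ k := by
  induction k with
  | zero => rw [pow_zero, pow_zero, toBlock_one_self]
  | succ k ih => rw [pow_succ, toBlock_mul_of_sectorPreserving_right p _ hX, ih, pow_succ]

open NormedSpace in
/-- **Compression commutes with the exponential** for sector-preserving `X`: `(e^{X})_p = e^{X_p}`
(the exponential series term by term). [folklore] -/
theorem toBlock_exp_of_sectorPreserving {X : Matrix ι ι ℂ}
    (hX : ∀ i j, p i → ¬ p j → X i j = 0 ∧ X j i = 0) :
    (exp X).toBlock p p = exp (X.toBlock p p) := by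
  have hs := exp_series_hasSum_exp' (𝕂 := ℂ) X
  let g : Matrix ι ι ℂ →+ Matrix {a // p a} {a // p a} ℂ :=
    { toFun := fun Y => Y.toBlock p p, map_zero' := rfl, map_add' := fun _ _ => rfl }
  have hg : Continuous g := continuous_id.matrix_submatrix _ _
  have h1 : HasSum (fun k => ((k.factorial : ℂ)⁻¹ • X ^ k).toBlock p p) ((exp X).toBlock p p) :=
    hs.map g hg
  have heq : (fun k => ((k.factorial : ℂ)⁻¹ • X ^ k).toBlock p p) =
      fun k => (k.factorial : ℂ)⁻¹ • (X.toBlock p p) ^ k := by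
    funext k
    rw [← toBlock_pow_of_sectorPreserving p hX k]
    rfl
  rw [heq] at h1
  exact h1.unique (exp_series_hasSum_exp' (𝕂 := ℂ) (X.toBlock p p))

/-- `(e^{-βH})_p = e^{-βH_p}` for sector-preserving `H`. [folklore] -/
theorem toBlock_gibbsWeight_of_sectorPreserving (β : ℝ) {H : Matrix ι ι ℂ}
    (hH : ∀ i j, p i → ¬ p j → H i j = 0 ∧ H j i = 0) :
    (gibbsWeight β H).toBlock p p = gibbsWeight β (H.toBlock p p) := by
  rw [gibbsWeight, gibbsWeight, toBlock_exp_of_sectorPreserving p (sectorPreserving_smul p _ hH)]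
  rfl

omit [Fintype ι] [DecidableEq ι] [DecidablePred p] in
/-- Compressions of Hermitian matrices are Hermitian. [folklore] -/
theorem isHermitian_toBlock {H : Matrix ι ι ℂ} (hH : H.IsHermitian) : (H.toBlock p p).IsHermitian :=
  hH.submatrix _

/-- **Compression does not increase the operator norm**: `‖X‖ ≤ R ⟹ ‖X_p‖ ≤ R` (`X_p = P X Pᴴ` with the
coordinate co-isometry `P`). [folklore] -/
theorem norm_toBlock_le_of_le {X : Matrix ι ι ℂ} {R : ℝ} (h : ‖X‖ ≤ R) : ‖X.toBlock p p‖ ≤ R := by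
  set P : Matrix {a // p a} ι ℂ := (1 : Matrix ι ι ℂ).submatrix Subtype.val id with hP
  have hB : X.toBlock p p = P * X * Pᴴ := by
    ext s t
    simp [hP, Matrix.mul_apply, Matrix.one_apply, toBlock_apply]
  have hPP : P * Pᴴ = 1 := by
    ext s t
    simp [hP, Matrix.mul_apply, Matrix.one_apply, Subtype.val_inj]
  have h1 : ‖(1 : Matrix {a // p a} {a // p a} ℂ)‖ ≤ 1 := by
    rw [Matrix.cstar_norm_def, map_one, ContinuousLinearMap.one_def]
    exact ContinuousLinearMap.norm_id_le
  have hPn : ‖Pᴴ‖ ≤ 1 := by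
    have h := l2_opNorm_conjTranspose_mul_self Pᴴ
    rw [conjTranspose_conjTranspose, hPP] at h
    nlinarith [norm_nonneg Pᴴ, h1, h]
  have hPn' : ‖P‖ ≤ 1 := by rw [← l2_opNorm_conjTranspose]; exact hPn
  rw [hB]
  calc ‖P * X * Pᴴ‖ ≤ ‖P * X‖ * ‖Pᴴ‖ := l2_opNorm_mul _ _
    _ ≤ ‖P‖ * ‖X‖ * ‖Pᴴ‖ := mul_le_mul_of_nonneg_right (l2_opNorm_mul _ _) (norm_nonneg _)
    _ ≤ 1 * ‖X‖ * 1 := by gcongr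
    _ = ‖X‖ := by ring
    _ ≤ R := h

end Block

/-! ## §2 The LPPL identities -/

section Identities

variable (p : ι → Prop) [DecidablePred p]

/-- **QBP conjugation compresses**: `e^{-β(H+V)_p} = E_p e^{-βH_p} E_pᴴ`. [cite: CapelEtAl2023, Proposition 6 (a)] -/
theorem gibbsWeight_block_perturbed_eq {H V E : Matrix ι ι ℂ} {β : ℝ}
    (hHp : ∀ i j, p i → ¬ p j → H i j = 0 ∧ H j i = 0) (hVp : ∀ i j, p i → ¬ p j → V i j = 0 ∧ V j i = 0)
    (hEp : ∀ i j, p i → ¬ p j → E i j = 0 ∧ E j i = 0)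
    (hE : gibbsWeight β (H + V) = E * gibbsWeight β H * Eᴴ) :
    gibbsWeight β ((H + V).toBlock p p) = E.toBlock p p * gibbsWeight β (H.toBlock p p) * (E.toBlock p p)ᴴ := by
  rw [← toBlock_gibbsWeight_of_sectorPreserving p β (sectorPreserving_add p hHp hVp), hE,
    toBlock_mul_of_sectorPreserving_right p _ (sectorPreserving_conjTranspose p hEp),
    toBlock_mul_of_sectorPreserving_left p hEp, toBlock_gibbsWeight_of_sectorPreserving p β hHp,
    conjTranspose_toBlock]

/-- `Z_p(H+V) = tr (e^{-βH_p} E_pᴴ E_p)`. [cite: CapelEtAl2023, proof of Theorem 14] -/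
theorem partitionFn_block_perturbed_eq {H V E : Matrix ι ι ℂ} {β : ℝ}
    (hHp : ∀ i j, p i → ¬ p j → H i j = 0 ∧ H j i = 0) (hVp : ∀ i j, p i → ¬ p j → V i j = 0 ∧ V j i = 0)
    (hEp : ∀ i j, p i → ¬ p j → E i j = 0 ∧ E j i = 0)
    (hE : gibbsWeight β (H + V) = E * gibbsWeight β H * Eᴴ) :
    partitionFn β ((H + V).toBlock p p) =
      (gibbsWeight β (H.toBlock p p) * ((E.toBlock p p)ᴴ * E.toBlock p p)).trace := by
  rw [partitionFn, gibbsWeight_block_perturbed_eq p hHp hVp hEp hE, Matrix.trace_mul_cycle, Matrix.trace_mul_comm]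

/-- `tr (e^{-β(H+V)_p} A') = tr (e^{-βH_p} E_pᴴ A' E_p)`. [cite: CapelEtAl2023, proof of Theorem 14] -/
theorem trace_gibbsWeight_block_perturbed_mul {H V E : Matrix ι ι ℂ} {β : ℝ}
    (hHp : ∀ i j, p i → ¬ p j → H i j = 0 ∧ H j i = 0) (hVp : ∀ i j, p i → ¬ p j → V i j = 0 ∧ V j i = 0)
    (hEp : ∀ i j, p i → ¬ p j → E i j = 0 ∧ E j i = 0)
    (hE : gibbsWeight β (H + V) = E * gibbsWeight β H * Eᴴ) (A' : Matrix {a // p a} {a // p a} ℂ) :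
    (gibbsWeight β ((H + V).toBlock p p) * A').trace =
      (gibbsWeight β (H.toBlock p p) * ((E.toBlock p p)ᴴ * A' * E.toBlock p p)).trace := by
  rw [gibbsWeight_block_perturbed_eq p hHp hVp hEp hE]
  rw [show E.toBlock p p * gibbsWeight β (H.toBlock p p) * (E.toBlock p p)ᴴ * A' =
      E.toBlock p p * (gibbsWeight β (H.toBlock p p) * ((E.toBlock p p)ᴴ * A')) by noncomm_ring,
    Matrix.trace_mul_comm, Matrix.mul_assoc, Matrix.mul_assoc]

/-- **The LPPL identity** `ρ₁(A') · ρ₀(E_pᴴ E_p) = ρ₀(E_pᴴ A' E_p)` (cross-multiplied form, valid also for the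
empty sector). [cite: CapelEtAl2023, proof of Theorem 14, eq. (4.3)] -/
theorem gibbsState_block_perturbed_mul_eq {H V E : Matrix ι ι ℂ} {β : ℝ} (hH : H.IsHermitian) (hV : V.IsHermitian)
    (hHp : ∀ i j, p i → ¬ p j → H i j = 0 ∧ H j i = 0) (hVp : ∀ i j, p i → ¬ p j → V i j = 0 ∧ V j i = 0)
    (hEp : ∀ i j, p i → ¬ p j → E i j = 0 ∧ E j i = 0)
    (hE : gibbsWeight β (H + V) = E * gibbsWeight β H * Eᴴ) (A' : Matrix {a // p a} {a // p a} ℂ) :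
    gibbsState β ((H + V).toBlock p p) A' * gibbsState β (H.toBlock p p) ((E.toBlock p p)ᴴ * E.toBlock p p) =
      gibbsState β (H.toBlock p p) ((E.toBlock p p)ᴴ * A' * E.toBlock p p) := by
  rcases isEmpty_or_nonempty {a // p a} with hι | hι
  · have h0 : ∀ Y : Matrix {a // p a} {a // p a} ℂ, Y = 0 := fun Y => Subsingleton.elim _ _
    rw [h0 ((E.toBlock p p)ᴴ * A' * E.toBlock p p), h0 A', map_zero, map_zero, zero_mul]
  have hHp' : (H.toBlock p p).IsHermitian := isHermitian_toBlock p hH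
  have hHVp' : ((H + V).toBlock p p).IsHermitian := isHermitian_toBlock p (hH.add hV)
  have hZ0 : partitionFn β (H.toBlock p p) ≠ 0 := fun h => by
    have := partitionFn_re_pos hHp' β; rw [h] at this; simp at this
  have hZ1 : partitionFn β ((H + V).toBlock p p) ≠ 0 := fun h => by
    have := partitionFn_re_pos hHVp' β; rw [h] at this; simp at this
  simp only [gibbsState_apply]
  rw [trace_gibbsWeight_block_perturbed_mul p hHp hVp hEp hE, ← partitionFn_block_perturbed_eq p hHp hVp hEp hE]
  field_simp

/-- **Free-energy lower bound for the QBP normalisation**: `ρ₀(E_pᴴE_p) = Z_p(H+V)/Z_p(H)` is real and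
`≥ e^{-β‖V‖}` (`|log Z_p(H+V) - log Z_p(H)| ≤ β‖V_p‖ ≤ β‖V‖`). [cite: CapelEtAl2023, proof of Theorem 14, eq. (4.5)] -/
theorem gibbsState_qbpNormalisation_eq {H V E : Matrix ι ι ℂ} {β : ℝ} (hH : H.IsHermitian) (hV : V.IsHermitian)
    (hβ : 0 ≤ β) [Nonempty {a // p a}]
    (hHp : ∀ i j, p i → ¬ p j → H i j = 0 ∧ H j i = 0) (hVp : ∀ i j, p i → ¬ p j → V i j = 0 ∧ V j i = 0)
    (hEp : ∀ i j, p i → ¬ p j → E i j = 0 ∧ E j i = 0)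
    (hE : gibbsWeight β (H + V) = E * gibbsWeight β H * Eᴴ) :
    ∃ D : ℝ, Real.exp (-(β * ‖V‖)) ≤ D ∧
      gibbsState β (H.toBlock p p) ((E.toBlock p p)ᴴ * E.toBlock p p) = (D : ℂ) := by
  have hHp' : (H.toBlock p p).IsHermitian := isHermitian_toBlock p hH
  have hHVp' : ((H + V).toBlock p p).IsHermitian := isHermitian_toBlock p (hH.add hV)
  have hZ0pos := partitionFn_re_pos hHp' β
  have hZ1pos := partitionFn_re_pos hHVp' β
  refine ⟨(partitionFn β ((H + V).toBlock p p)).re / (partitionFn β (H.toBlock p p)).re, ?_, ?_⟩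
  · have h := log_partitionFn_sub_log_partitionFn_le hHp' hHVp' hβ
    have hVn : ‖(H + V).toBlock p p - H.toBlock p p‖ ≤ ‖V‖ := by
      rw [show (H + V).toBlock p p - H.toBlock p p = V.toBlock p p by ext a b; simp]
      exact norm_toBlock_le_of_le p le_rfl
    rw [le_div_iff₀ hZ0pos, ← Real.exp_log hZ0pos, ← Real.exp_add, ← Real.exp_log hZ1pos]
    refine Real.exp_le_exp.2 ?_
    nlinarith
  · have e0 := partitionFn_eq_re hHp' β
    have e1 := partitionFn_eq_re hHVp' β
    rw [gibbsState_apply, ← partitionFn_block_perturbed_eq p hHp hVp hEp hE]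
    generalize (partitionFn β (H.toBlock p p)).re = r0 at e0 hZ0pos
    generalize (partitionFn β ((H + V).toBlock p p)).re = r1 at e1 hZ1pos
    rw [e0, e1, Complex.ofReal_div]
    have : (r0 : ℂ) ≠ 0 := by exact_mod_cast hZ0pos.ne'
    field_simp

end Identities

/-! ## §3 The estimate: local perturbations perturb locally, inside the sector -/

/-- **Local perturbations perturb locally (canonical-sector form of CMTW Thm 14).**  Let `H`, `V` be Hermitian and
sector preserving, `e^{-β(H+V)} = E e^{-βH} Eᴴ` the QBP conjugation (part 3), `E`, `Ẽ`, `A` sector preserving,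
`‖E‖, ‖Ẽ‖ ≤ R`, `‖E - Ẽ‖ ≤ δ`, `Ẽ A = A Ẽ`, and let `cov` bound the `ρ₀`-covariance of `(ẼᴴẼ)_p` and `A_p`
in the sector Gibbs state `ρ₀` of `H_p`.  Then the sector Gibbs state `ρ₁` of `(H+V)_p` satisfies
`|ρ₁(A_p) - ρ₀(A_p)| ≤ e^{β‖V‖} (cov + 4 R δ ‖A‖)`.
[cite: CapelEtAl2023, Theorem 14, proof eqs. (4.3)–(4.5); arXiv:2310.09182] -/
theorem norm_gibbsState_block_perturbed_sub_le (p : ι → Prop) [DecidablePred p]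
    {H V E Et A : Matrix ι ι ℂ} {β R δ cov : ℝ} (hH : H.IsHermitian) (hV : V.IsHermitian) (hβ : 0 ≤ β)
    (hHp : ∀ i j, p i → ¬ p j → H i j = 0 ∧ H j i = 0) (hVp : ∀ i j, p i → ¬ p j → V i j = 0 ∧ V j i = 0)
    (hEp : ∀ i j, p i → ¬ p j → E i j = 0 ∧ E j i = 0) (hEtp : ∀ i j, p i → ¬ p j → Et i j = 0 ∧ Et j i = 0)
    (hAp : ∀ i j, p i → ¬ p j → A i j = 0 ∧ A j i = 0)
    (hE : gibbsWeight β (H + V) = E * gibbsWeight β H * Eᴴ)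
    (hEn : ‖E‖ ≤ R) (hEtn : ‖Et‖ ≤ R) (hδ : ‖E - Et‖ ≤ δ) (hcomm : Et * A = A * Et)
    (hcov : ‖gibbsState β (H.toBlock p p) ((Etᴴ * Et * A).toBlock p p) -
        gibbsState β (H.toBlock p p) ((Etᴴ * Et).toBlock p p) * gibbsState β (H.toBlock p p) (A.toBlock p p)‖ ≤ cov) :
    ‖gibbsState β ((H + V).toBlock p p) (A.toBlock p p) - gibbsState β (H.toBlock p p) (A.toBlock p p)‖ ≤
      Real.exp (β * ‖V‖) * (cov + 4 * R * δ * ‖A‖) := by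
  have hcov0 : 0 ≤ cov := (norm_nonneg _).trans hcov
  have hR0 : 0 ≤ R := (norm_nonneg _).trans hEn
  have hδ0 : 0 ≤ δ := (norm_nonneg _).trans hδ
  rcases isEmpty_or_nonempty {a // p a} with hι | hι
  · have h0 : A.toBlock p p = 0 := Subsingleton.elim _ _
    rw [h0, map_zero, map_zero, sub_zero, norm_zero]
    positivity
  -- notation
  set Hp := H.toBlock p p with hHpdef
  set Ep := E.toBlock p p with hEpdef
  set Etp := Et.toBlock p p with hEtpdef
  set Ap := A.toBlock p p with hApdef
  set ρ₀ := gibbsState β Hp with hρ₀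
  set ρ₁ := gibbsState β ((H + V).toBlock p p) with hρ₁
  have hHp' : Hp.IsHermitian := isHermitian_toBlock p hH
  -- block products
  have hEtA : (Etᴴ * Et * A).toBlock p p = Etpᴴ * Etp * Ap := by
    rw [toBlock_mul_of_sectorPreserving_right p _ hAp, toBlock_mul_of_sectorPreserving_right p _ hEtp,
      conjTranspose_toBlock]
  have hEtEt : (Etᴴ * Et).toBlock p p = Etpᴴ * Etp := by
    rw [toBlock_mul_of_sectorPreserving_right p _ hEtp, conjTranspose_toBlock]
  have hcommp : Etp * Ap = Ap * Etp := by
    have h1 : (Et * A).toBlock p p = Etp * Ap := toBlock_mul_of_sectorPreserving_right p _ hAp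
    have h2 : (A * Et).toBlock p p = Ap * Etp := toBlock_mul_of_sectorPreserving_right p _ hEtp
    rw [← h1, ← h2, hcomm]
  rw [hEtA, hEtEt] at hcov
  -- the normalisation `D = ρ₀(E_pᴴ E_p) ≥ e^{-β‖V‖}` and the LPPL identity
  obtain ⟨D, hDle, hD⟩ := gibbsState_qbpNormalisation_eq p hH hV hβ hHp hVp hEp hE
  have hDpos : 0 < D := (Real.exp_pos _).trans_le hDle
  have hident : ρ₁ Ap * (D : ℂ) = ρ₀ (Epᴴ * Ap * Ep) := by
    rw [← hD]; exact gibbsState_block_perturbed_mul_eq p hH hV hHp hVp hEp hE Ap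
  have hD' : ρ₀ (Epᴴ * Ep) = (D : ℂ) := hD
  -- the numerator
  have hnum : ρ₁ Ap - ρ₀ Ap =
      (ρ₀ (Epᴴ * Ap * Ep - Etpᴴ * Ap * Etp) + (ρ₀ (Etpᴴ * Etp * Ap) - ρ₀ (Etpᴴ * Etp) * ρ₀ Ap) +
        ρ₀ Ap * ρ₀ (Etpᴴ * Etp - Epᴴ * Ep)) / (D : ℂ) := by
    have hD0 : (D : ℂ) ≠ 0 := by exact_mod_cast hDpos.ne'
    rw [eq_div_iff hD0, sub_mul, hident, map_sub, map_sub, hD',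
      show Etpᴴ * Ap * Etp = Etpᴴ * Etp * Ap by rw [Matrix.mul_assoc, ← hcommp, Matrix.mul_assoc]]
    ring
  -- norm bounds
  have hρle : ∀ Y, ‖ρ₀ Y‖ ≤ ‖Y‖ := fun Y => norm_gibbsState_le hHp' β Y
  have hEpn : ‖Ep‖ ≤ R := norm_toBlock_le_of_le p hEn
  have hEtpn : ‖Etp‖ ≤ R := norm_toBlock_le_of_le p hEtn
  have hApn : ‖Ap‖ ≤ ‖A‖ := norm_toBlock_le_of_le p le_rfl
  have hdp : ‖Ep - Etp‖ ≤ δ := by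
    rw [show Ep - Etp = (E - Et).toBlock p p by ext a b; simp [hEpdef, hEtpdef]]
    exact norm_toBlock_le_of_le p hδ
  have h1 : ‖Epᴴ * Ap * Ep - Etpᴴ * Ap * Etp‖ ≤ 2 * R * δ * ‖A‖ := by
    rw [show Epᴴ * Ap * Ep - Etpᴴ * Ap * Etp = (Ep - Etp)ᴴ * Ap * Ep + Etpᴴ * Ap * (Ep - Etp) by
      rw [conjTranspose_sub]; noncomm_ring]
    refine (norm_add_le _ _).trans ?_
    have ha : ‖(Ep - Etp)ᴴ * Ap * Ep‖ ≤ δ * ‖A‖ * R := by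
      calc ‖(Ep - Etp)ᴴ * Ap * Ep‖ ≤ ‖(Ep - Etp)ᴴ * Ap‖ * ‖Ep‖ := l2_opNorm_mul _ _
        _ ≤ ‖(Ep - Etp)ᴴ‖ * ‖Ap‖ * ‖Ep‖ := mul_le_mul_of_nonneg_right (l2_opNorm_mul _ _) (norm_nonneg _)
        _ ≤ δ * ‖A‖ * R := by rw [l2_opNorm_conjTranspose]; gcongr
    have hb : ‖Etpᴴ * Ap * (Ep - Etp)‖ ≤ R * ‖A‖ * δ := by
      calc ‖Etpᴴ * Ap * (Ep - Etp)‖ ≤ ‖Etpᴴ * Ap‖ * ‖Ep - Etp‖ := l2_opNorm_mul _ _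
        _ ≤ ‖Etpᴴ‖ * ‖Ap‖ * ‖Ep - Etp‖ := mul_le_mul_of_nonneg_right (l2_opNorm_mul _ _) (norm_nonneg _)
        _ ≤ R * ‖A‖ * δ := by rw [l2_opNorm_conjTranspose]; gcongr
    nlinarith
  have h2 : ‖Etpᴴ * Etp - Epᴴ * Ep‖ ≤ 2 * R * δ := by
    rw [show Etpᴴ * Etp - Epᴴ * Ep = (Etp - Ep)ᴴ * Etp + Epᴴ * (Etp - Ep) by rw [conjTranspose_sub]; noncomm_ring]
    refine (norm_add_le _ _).trans ?_
    have hdp' : ‖Etp - Ep‖ ≤ δ := by rw [norm_sub_rev]; exact hdp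
    have ha : ‖(Etp - Ep)ᴴ * Etp‖ ≤ δ * R := by
      calc ‖(Etp - Ep)ᴴ * Etp‖ ≤ ‖(Etp - Ep)ᴴ‖ * ‖Etp‖ := l2_opNorm_mul _ _
        _ ≤ δ * R := by rw [l2_opNorm_conjTranspose]; gcongr
    have hb : ‖Epᴴ * (Etp - Ep)‖ ≤ R * δ := by
      calc ‖Epᴴ * (Etp - Ep)‖ ≤ ‖Epᴴ‖ * ‖Etp - Ep‖ := l2_opNorm_mul _ _
        _ ≤ R * δ := by rw [l2_opNorm_conjTranspose]; gcongr
    nlinarith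
  have hN : ‖ρ₀ (Epᴴ * Ap * Ep - Etpᴴ * Ap * Etp) + (ρ₀ (Etpᴴ * Etp * Ap) - ρ₀ (Etpᴴ * Etp) * ρ₀ Ap) +
      ρ₀ Ap * ρ₀ (Etpᴴ * Etp - Epᴴ * Ep)‖ ≤ cov + 4 * R * δ * ‖A‖ := by
    refine (norm_add_le _ _).trans ?_
    refine (add_le_add (norm_add_le _ _) le_rfl).trans ?_
    have e1 := (hρle _).trans h1
    have e3 : ‖ρ₀ Ap * ρ₀ (Etpᴴ * Etp - Epᴴ * Ep)‖ ≤ ‖A‖ * (2 * R * δ) := by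
      rw [norm_mul]
      exact mul_le_mul ((hρle _).trans hApn) ((hρle _).trans h2) (norm_nonneg _) (norm_nonneg _)
    nlinarith [hcov, norm_nonneg A]
  -- conclusion
  rw [hnum, norm_div, Complex.norm_real, Real.norm_of_nonneg hDpos.le, div_le_iff₀ hDpos]
  calc _ ≤ cov + 4 * R * δ * ‖A‖ := hN
    _ = Real.exp (β * ‖V‖) * Real.exp (-(β * ‖V‖)) * (cov + 4 * R * δ * ‖A‖) := by
        rw [← Real.exp_add, add_neg_cancel, Real.exp_zero, one_mul]
    _ = Real.exp (β * ‖V‖) * (cov + 4 * R * δ * ‖A‖) * Real.exp (-(β * ‖V‖)) := by ring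
    _ ≤ Real.exp (β * ‖V‖) * (cov + 4 * R * δ * ‖A‖) * D := by
        have : 0 ≤ Real.exp (β * ‖V‖) * (cov + 4 * R * δ * ‖A‖) := by positivity
        exact mul_le_mul_of_nonneg_left hDle this

end Summit.Ventures.CertifiedManyBodySolver.Theorems.TcThermcert1.GaugeQbpFarSeam

end
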